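import Summits.NavierStokesRegularity.NavierStokesRegularity.Theses.TypeILiouville
import Summits.NavierStokesRegularity.NavierStokesRegularity.Theorems.TypeILiouvilleTypeIliouvilleNoTypeIIOfWindowActivity
import HarnessLib

/-!
# A Type-II blow-up generates a non-zero bounded ETERNAL profile — with the zoom data exposed
# (crux `TypeIliouvilleNoTypeII`, stmt-NavierStokesRegularity-0056; the Liouville-side reduction)

Let `(u, p)` be a maximal classical solution of unforced Navier–Stokes (`ν > 0`) on `ℝ³ × [0, T)`,
Leray–Hopf from a rapidly decaying datum — the hypotheses of the hard core `NoTypeII`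
(`Theses.TypeILiouville.TypeIliouvilleNoTypeII`).  If the blow-up at `T` is NOT of Type I, this
file produces (`exists_eternalProfile_of_not_isTypeIBlowup`):

* near-maximum CENTRES `(t_k, x_k)`, `t_k ∈ [0, T)`, `t_k > T − 1/(k+1)`, and LEVELS `M_k > 0`
  with the Type-II signature `k √ν ≤ M_k √(T − t_k)` (the self-similar rate is violated at level
  `k` at the centre), such that `‖u‖ ≤ M_k` on the whole space throughout the TWO-SIDED physical
  window `[t_k − kν/M_k², t_k + kν/M_k²] ⊆ (0, T)` and `M_k ≤ 4‖u(t_k, x_k)‖`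
  (`exists_nearMaxWindows_of_not_isTypeIBlowup`: the sup-norm modulus `stub_supNorm`, Leray's lower
  rate, `unbounded_of_not_isTypeIBlowup`, and the Poláčik–Quittner–Souplet time doubling
  `stub_timeDoubling` — all landed by the line `Sketch` of this crux);
* the viscosity-normalising parabolic ZOOMS `w_k(s, y) = M_k⁻¹ u(t_k + sν/M_k², x_k + yν/M_k)`
  (unit viscosity, `|w_k| ≤ 1` on `(−k, k) × ℝ³`, `‖w_k(0, 0)‖ ≥ 1/4`);
* a subsequence `φ` and a bounded ETERNAL limit `W : ℝ × ℝ³ → ℝ³` — jointly smooth, divergence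
  free, Oseen-mild between all pairs of times (unit viscosity), `‖W‖ ≤ 1`, `‖W(0, 0)‖ ≥ 1/4` — to
  which the `w_{φ j}` converge at every point of `ℝ × ℝ³` together with their spatial gradients
  (`exists_tendsto_of_bounded_seq`, KNSS 2009 Lemma 6.1 / Prop. 4.1 run on two-sided windows).

Purpose.  This is the common first half of every LIOUVILLE-TYPE Type-II exclusion: an a-priori
scale-invariant quantity `X(u)` that passes to pointwise(-with-gradients) limits of the zooms is
inherited by `W`, and the candidate estimate «Type-II blow-up is excluded in the class `X < ∞`»
becomes the Liouville statement «bounded eternal mild solutions with `X < ∞` and `W(0,0) ≠ 0` do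
not exist».  The registered line `eternal_split` of this crux (Cruxes/TypeIliouvilleNoTypeII/Lines)
is the instance `X = 𝐈` (Albritton–Barker's scaled energies): its stub
`stub_eternalProfileOfTypeII` is this theorem plus the inheritance of `𝐈`.  Because the zoom data
are exposed (centres, levels, windows, the subsequence and both convergences), consumers bolt
their inheritance argument on without re-running the extraction.  Without an inherited `X`
nothing excludes `W ≡ const` (KNSS's conjecture (L) allows constants), which is why the packaged
corollary `exists_eternalProfile_of_not_isTypeIBlowup'` is a tool and not a contradiction.

Nothing here is a claim about Navier–Stokes regularity; no blow-up is excluded.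

References: Koch–Nadirashvili–Seregin–Šverák 2009 (Acta Math. 203 = arXiv:0709.3599), §6
Lemma 6.1, Prop. 4.1; Poláčik–Quittner–Souplet 2007, Lemma 5.1 (doubling); Giga–Miura 2011
(blow-up argument at near-maxima); Leray 1934 §19–21.
-/

noncomputable section

-- the summit and its single problem share the name `NavierStokesRegularity` (D-0017 nested layout)
set_option linter.dupNamespace false

open Set Function Filter Topology MeasureTheory Metric
open scoped NNReal ENNReal

namespace Summit.NavierStokesRegularity.NavierStokesRegularity.Theorems.TypeIliouvilleNoTypeII.EternalProfile

open Literature.Analysis Literature.Analysis.FluidPDE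
open Summit.NavierStokesRegularity.NavierStokesRegularity.Theorems.TypeIliouvilleNoTypeII.ImmortalZoom

/-! ## Near-maximum two-sided windows at a Type-II blow-up -/

/-- **Type-II windows.**  At a blow-up which is not of Type I, for every `k : ℕ` there are a late
time `t ∈ [0, T)`, `t > T − 1/(k+1)`, a level `M > 0` violating the self-similar rate at order
`k` (`k√ν ≤ M√(T − t)`), and a near-maximum point `x₀` (`M ≤ 4‖u(t, x₀)‖`), such that
`‖u‖ ≤ M` everywhere in space throughout the two-sided window `[t − kν/M², t + kν/M²] ⊆ (0, T)`.
Proof: the sup-norm modulus `m` (`stub_supNorm`) has `m(t)√(T − t)` unbounded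
(`unbounded_of_not_isTypeIBlowup`); time doubling (`stub_timeDoubling`, parameter
`√(max(k², 1)·ν)`) gives a late `t` with `m ≤ 2m(t)` on `[t − max(k²,1)ν/m(t)², t + max(k²,1)ν/m(t)²]`;
take `M = 2m(t)` and a point with `‖u(t, x₀)‖ > m(t)/2`.
[cite: KochNadirashviliSereginSverak2009, §6 Lemma 6.1 (arXiv:0709.3599 p. 11)] -/
theorem exists_nearMaxWindows_of_not_isTypeIBlowup (ν T : ℝ) (hν : 0 < ν) (hT : 0 < T)
    (u : ℝ → EuclideanSpace ℝ (Fin 3) → EuclideanSpace ℝ (Fin 3))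
    (p : ℝ → EuclideanSpace ℝ (Fin 3) → ℝ) (hmax : IsMaximalSmoothSolution ν 0 u p T)
    (hLH : IsLerayHopfOn T ν 0 (u 0) u) (hdec : HasRapidSpatialDecay (u 0))
    (hII : ¬ IsTypeIBlowup u T) (k : ℕ) :
    ∃ t M : ℝ, ∃ x₀ : EuclideanSpace ℝ (Fin 3), 0 < M ∧ t ∈ Ico 0 T ∧ T - 1 / ((k : ℝ) + 1) < t ∧
      (k : ℝ) * Real.sqrt ν ≤ M * Real.sqrt (T - t) ∧
      Icc (t - k * ν / M ^ 2) (t + k * ν / M ^ 2) ⊆ Ioo 0 T ∧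
      (∀ s ∈ Icc (t - k * ν / M ^ 2) (t + k * ν / M ^ 2), ∀ x, ‖u s x‖ ≤ M) ∧
      M ≤ 4 * ‖u t x₀‖ := by
  obtain ⟨m, hmc, hle, hnear, c, hc, hler⟩ := stub_supNorm ν T hν hT u p hmax hLH hdec
  have hpos : ∀ t ∈ Ico 0 T, 0 < m t := fun t ht =>
    lt_of_lt_of_le (div_pos hc (Real.sqrt_pos.2 (by linarith [ht.2]))) (hler t ht)
  have hunb := unbounded_of_not_isTypeIBlowup hle hT hII
  -- doubling with parameter `√(K ν)`, `K = max (k², 1)`, beyond `t₁ = T − 1/(k+1)`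
  set K : ℝ := max ((k : ℝ) ^ 2) 1 with hK
  have hK1 : 1 ≤ K := le_max_right _ _
  have hK0 : 0 < K := lt_of_lt_of_le one_pos hK1
  have hKk : (k : ℝ) ^ 2 ≤ K := le_max_left _ _
  have hKν : 0 < Real.sqrt (K * ν) := Real.sqrt_pos.2 (mul_pos hK0 hν)
  have hk1 : (0 : ℝ) < (k : ℝ) + 1 := by positivity
  have ht₁ : T - 1 / ((k : ℝ) + 1) < T := by
    have : 0 < 1 / ((k : ℝ) + 1) := by positivity
    linarith
  obtain ⟨t, ht, ht₁t, hrate, hleft, hright, hdoub⟩ :=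
    stub_timeDoubling (k := Real.sqrt (K * ν)) (a := 0) hKν hmc hpos hunb _ ht₁
  have hMt : 0 < m t := hpos t ht
  have hsq : Real.sqrt (K * ν) ^ 2 = K * ν := Real.sq_sqrt (mul_pos hK0 hν).le
  rw [hsq] at hleft hright hdoub
  refine ⟨t, 2 * m t, ?_⟩
  -- a near-maximum point
  obtain ⟨x₀, hx₀⟩ := hnear t ht (m t / 2) (by linarith)
  -- the `M`-window lies inside the doubling window: `k ν/(2 m t)² ≤ K ν/(m t)²`
  have hwin : (k : ℝ) * ν / (2 * m t) ^ 2 ≤ K * ν / m t ^ 2 := by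
    rw [div_le_div_iff₀ (by positivity) (by positivity)]
    have hk4 : (k : ℝ) ≤ 4 * K := by
      have hk0 : (0 : ℝ) ≤ k := Nat.cast_nonneg k
      rcases le_or_gt (k : ℝ) 1 with h | h
      · linarith
      · nlinarith
    have hνm : 0 ≤ ν * m t ^ 2 := by positivity
    calc (k : ℝ) * ν * m t ^ 2 = (k : ℝ) * (ν * m t ^ 2) := by ring
      _ ≤ 4 * K * (ν * m t ^ 2) := mul_le_mul_of_nonneg_right hk4 hνm
      _ = K * ν * (2 * m t) ^ 2 := by ring
  have hinc : Icc (t - (k : ℝ) * ν / (2 * m t) ^ 2) (t + (k : ℝ) * ν / (2 * m t) ^ 2) ⊆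
      Icc (t - K * ν / m t ^ 2) (t + K * ν / m t ^ 2) := fun s hs =>
    ⟨by linarith [hs.1], by linarith [hs.2]⟩
  refine ⟨x₀, by linarith, ht, ht₁t, ?_, ?_, ?_, by linarith⟩
  · -- `k √ν ≤ √(K ν) < m t √(T − t) ≤ 2 m t √(T − t)`
    have h1 : (k : ℝ) * Real.sqrt ν ≤ Real.sqrt (K * ν) := by
      rw [Real.sqrt_mul hK0.le]
      refine mul_le_mul_of_nonneg_right ?_ (Real.sqrt_nonneg _)
      calc (k : ℝ) = Real.sqrt ((k : ℝ) ^ 2) := (Real.sqrt_sq (Nat.cast_nonneg k)).symm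
        _ ≤ Real.sqrt K := Real.sqrt_le_sqrt hKk
    have h2 : m t * Real.sqrt (T - t) ≤ 2 * m t * Real.sqrt (T - t) := by
      have := Real.sqrt_nonneg (T - t)
      nlinarith
    linarith
  · intro s hs
    have hs' := hinc hs
    exact ⟨lt_of_lt_of_le hleft hs'.1, lt_of_le_of_lt hs'.2 hright⟩
  · intro s hs x
    have hs' := hinc hs
    have hsI : s ∈ Ico 0 T := ⟨(lt_of_lt_of_le hleft hs'.1).le, lt_of_le_of_lt hs'.2 hright⟩
    exact (hle s hsI x).trans (hdoub s hs')

/-! ## The eternal profile -/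

/-- The value of a window zoom at the space–time origin is the rescaled centre value
`M⁻¹ u(t₀, x₀)`. [folklore] -/
theorem windowZoom_zero_zero {ν M t₀ : ℝ}
    {u : ℝ → EuclideanSpace ℝ (Fin 3) → EuclideanSpace ℝ (Fin 3)} {x₀ : EuclideanSpace ℝ (Fin 3)} :
    (M⁻¹ • stPull (ν / M ^ 2) (ν / M) t₀ x₀ u) 0 0 = M⁻¹ • u t₀ x₀ := by
  show M⁻¹ • stPull (ν / M ^ 2) (ν / M) t₀ x₀ u 0 0 = M⁻¹ • u t₀ x₀
  rw [stPull_apply, mul_zero, add_zero, smul_zero, add_zero]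

/-- **A Type-II blow-up generates a non-zero bounded eternal profile (zoom data exposed).**  See
the module docstring.  Output: centres `tc`, `xc`, levels `M`, a subsequence `φ` and the limit `W`
with: `M k > 0`; `tc k ∈ [0, T)`, `T − 1/(k+1) < tc k`; the Type-II signature
`k√ν ≤ M k · √(T − tc k)`; the two-sided sup-controlled windows; `M k ≤ 4‖u(tc k, xc k)‖`;
`W` jointly smooth, divergence free, Oseen-mild (unit viscosity) between all times, `‖W‖ ≤ 1`,
`1/4 ≤ ‖W(0, 0)‖`; and pointwise convergence on `ℝ × ℝ³` of the zooms
`w_{φ j} = (M (φ j))⁻¹ • stPull (ν/M(φ j)²) (ν/M(φ j)) (tc (φ j)) (xc (φ j)) u` and of their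
spatial gradients to `W` and `∇W`.
[cite: KochNadirashviliSereginSverak2009, §6 Lemma 6.1 and Prop. 4.1 (arXiv:0709.3599 pp. 8, 11)] -/
theorem exists_eternalProfile_of_not_isTypeIBlowup (ν T : ℝ) (hν : 0 < ν) (hT : 0 < T)
    (u : ℝ → EuclideanSpace ℝ (Fin 3) → EuclideanSpace ℝ (Fin 3))
    (p : ℝ → EuclideanSpace ℝ (Fin 3) → ℝ) (hmax : IsMaximalSmoothSolution ν 0 u p T)
    (hLH : IsLerayHopfOn T ν 0 (u 0) u) (hdec : HasRapidSpatialDecay (u 0))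
    (hII : ¬ IsTypeIBlowup u T) :
    ∃ (tc : ℕ → ℝ) (xc : ℕ → EuclideanSpace ℝ (Fin 3)) (M : ℕ → ℝ) (φ : ℕ → ℕ)
      (W : ℝ → EuclideanSpace ℝ (Fin 3) → EuclideanSpace ℝ (Fin 3)),
      StrictMono φ ∧
      (∀ k : ℕ, 0 < M k) ∧
      (∀ k : ℕ, tc k ∈ Ico 0 T) ∧
      (∀ k : ℕ, T - 1 / ((k : ℝ) + 1) < tc k) ∧
      (∀ k : ℕ, (k : ℝ) * Real.sqrt ν ≤ M k * Real.sqrt (T - tc k)) ∧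
      (∀ k : ℕ, Icc (tc k - (k : ℝ) * ν / M k ^ 2) (tc k + (k : ℝ) * ν / M k ^ 2) ⊆ Ioo 0 T) ∧
      (∀ k : ℕ, ∀ s ∈ Icc (tc k - (k : ℝ) * ν / M k ^ 2) (tc k + (k : ℝ) * ν / M k ^ 2),
        ∀ x, ‖u s x‖ ≤ M k) ∧
      (∀ k : ℕ, M k ≤ 4 * ‖u (tc k) (xc k)‖) ∧
      ContDiff ℝ (⊤ : ℕ∞) (uncurry W) ∧
      (∀ t, VectorCalculus.IsDivFree (W t)) ∧
      (∀ s t : ℝ, s < t → ∀ x, W t x = heatFlow (W s) (t - s) x - oseenDuhamel 1 s W W t x) ∧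
      (∀ t x, ‖W t x‖ ≤ 1) ∧
      (1 / 4 : ℝ) ≤ ‖W 0 0‖ ∧
      (∀ t x, Tendsto
        (fun j => ((M (φ j))⁻¹ • stPull (ν / M (φ j) ^ 2) (ν / M (φ j)) (tc (φ j)) (xc (φ j)) u) t x)
        atTop (𝓝 (W t x))) ∧
      (∀ t x, Tendsto
        (fun j => fderiv ℝ
          (((M (φ j))⁻¹ • stPull (ν / M (φ j) ^ 2) (ν / M (φ j)) (tc (φ j)) (xc (φ j)) u) t) x)
        atTop (𝓝 (fderiv ℝ (W t) x))) := by
  have hsol : IsClassicalNSSolutionOn (Ico 0 T) ν 0 u p := hmax.1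
  choose tc M xc hM htI hlate hsig hsub hbd hnear using
    exists_nearMaxWindows_of_not_isTypeIBlowup ν T hν hT u p hmax hLH hdec hII
  -- the window zooms
  set w : ℕ → ℝ → EuclideanSpace ℝ (Fin 3) → EuclideanSpace ℝ (Fin 3) :=
    fun k => (M k)⁻¹ • stPull (ν / M k ^ 2) (ν / M k) (tc k) (xc k) u with hw
  have hA : Tendsto (fun k : ℕ => -(k : ℝ)) atTop atBot :=
    tendsto_neg_atTop_atBot.comp tendsto_natCast_atTop_atTop
  have hB : Tendsto (fun k : ℕ => (k : ℝ)) atTop atTop := tendsto_natCast_atTop_atTop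
  have hc : ∀ k : ℕ, ContinuousOn (uncurry (w k)) (Ioo (-(k : ℝ)) k ×ˢ univ) := fun k =>
    windowZoom_continuousOn hν hsol (hM k) (hsub k)
  have hdivw : ∀ k : ℕ, ∀ t ∈ Ioo (-(k : ℝ)) k, IsWeaklyDivFree (w k t) := fun k t ht =>
    windowZoom_isWeaklyDivFree hν hsol (hM k) (hsub k) ht
  have hmild : ∀ k : ℕ, ∀ s t : ℝ, -(k : ℝ) < s → s < t → t < k → ∀ x,
      w k t x = UnboundedOperators.heatExtension (w k s) (t - s) x -
        oseenDuhamel 1 s (w k) (w k) t x := by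
    intro k s t hs hst ht x
    have hsI : s ∈ Ioo (-(k : ℝ)) k := ⟨hs, hst.trans ht⟩
    have htI : t ∈ Ioo (-(k : ℝ)) k := ⟨hs.trans hst, ht⟩
    exact windowZoom_oseen hν hT hsol hLH hdec (hM k) (windowZoom_time_mem hν (hM k) (hsub k) hsI).1
      hst (windowZoom_time_mem hν (hM k) (hsub k) htI).2 x
  have hbdw : ∀ k : ℕ, ∀ t ∈ Ioo (-(k : ℝ)) k, ∀ x, ‖w k t x‖ ≤ 1 := fun k t ht x =>
    windowZoom_norm_le_one hν (hM k) (hbd k) ht x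
  -- the extraction
  obtain ⟨φ, hφ, W, hWs, hWdiv, hWmild, hWbd, hval, hgrad⟩ :=
    exists_tendsto_of_bounded_seq 1 hA hB hc hdivw hmild hbdw
  refine ⟨tc, xc, M, φ, W, hφ, hM, htI, hlate, hsig, hsub, hbd, hnear, hWs, hWdiv, hWmild, hWbd,
    ?_, hval, hgrad⟩
  -- the centre survives: `‖w_k(0, 0)‖ = ‖u(tc k, xc k)‖/M k ≥ 1/4`
  have hk : ∀ k, (1 / 4 : ℝ) ≤ ‖w k 0 0‖ := fun k => by
    have h0 : w k 0 0 = (M k)⁻¹ • u (tc k) (xc k) := windowZoom_zero_zero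
    rw [h0, norm_smul, norm_inv, Real.norm_of_nonneg (hM k).le]
    rw [le_inv_mul_iff₀ (hM k)]
    linarith [hnear k]
  exact ge_of_tendsto (hval 0 0).norm (Eventually.of_forall fun j => hk (φ j))

/-- **Packaged form.**  At a blow-up which is not of Type I there is a bounded eternal Oseen-mild
smooth divergence-free field `W` on `ℝ × ℝ³` (unit viscosity) with `‖W‖ ≤ 1` and `W(0, 0) ≠ 0`.
(Without an inherited scale-invariant bound nothing excludes `W ≡ const`.)
[cite: KochNadirashviliSereginSverak2009, §6 Lemma 6.1 and Prop. 4.1 (arXiv:0709.3599 pp. 8, 11)] -/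
theorem exists_eternalProfile_of_not_isTypeIBlowup' (ν T : ℝ) (hν : 0 < ν) (hT : 0 < T)
    (u : ℝ → EuclideanSpace ℝ (Fin 3) → EuclideanSpace ℝ (Fin 3))
    (p : ℝ → EuclideanSpace ℝ (Fin 3) → ℝ) (hmax : IsMaximalSmoothSolution ν 0 u p T)
    (hLH : IsLerayHopfOn T ν 0 (u 0) u) (hdec : HasRapidSpatialDecay (u 0))
    (hII : ¬ IsTypeIBlowup u T) :
    ∃ W : ℝ → EuclideanSpace ℝ (Fin 3) → EuclideanSpace ℝ (Fin 3),
      ContDiff ℝ (⊤ : ℕ∞) (uncurry W) ∧ (∀ t, VectorCalculus.IsDivFree (W t)) ∧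
      (∀ s t : ℝ, s < t → ∀ x, W t x = heatFlow (W s) (t - s) x - oseenDuhamel 1 s W W t x) ∧
      (∀ t x, ‖W t x‖ ≤ 1) ∧ W 0 0 ≠ 0 := by
  obtain ⟨-, -, -, -, W, -, -, -, -, -, -, -, -, hWs, hWdiv, hWmild, hWbd, h0, -, -⟩ :=
    exists_eternalProfile_of_not_isTypeIBlowup ν T hν hT u p hmax hLH hdec hII
  refine ⟨W, hWs, hWdiv, hWmild, hWbd, fun h => ?_⟩
  rw [h, norm_zero] at h0
  linarith

/-- **The crux from a Liouville theorem for Type-II profiles** (reduction BY NAME for the hard core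
`Theses.TypeILiouville.TypeIliouvilleNoTypeII`).  Suppose that for every solution in the class of the
crux and every family of Type-II zoom data as produced above (late near-maximum centres, levels
with the Type-II signature, two-sided sup-controlled windows), every bounded eternal Oseen-mild
smooth divergence-free limit `W` (`‖W‖ ≤ 1`) of a subsequence of the zooms, with its gradients,
vanishes at the origin.  Then `NoTypeII`.  This is the slot into which an inherited a-priori bound
and its Liouville theorem are inserted. [cite: KochNadirashviliSereginSverak2009, §6 (arXiv:0709.3599 p. 11)] -/
theorem typeIliouvilleNoTypeII_of_profileLiouville
    (hL : ∀ (ν T : ℝ), 0 < ν → 0 < T →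
      ∀ (u : ℝ → EuclideanSpace ℝ (Fin 3) → EuclideanSpace ℝ (Fin 3))
        (p : ℝ → EuclideanSpace ℝ (Fin 3) → ℝ),
      IsMaximalSmoothSolution ν 0 u p T → IsLerayHopfOn T ν 0 (u 0) u →
      HasRapidSpatialDecay (u 0) →
      ∀ (tc : ℕ → ℝ) (xc : ℕ → EuclideanSpace ℝ (Fin 3)) (M : ℕ → ℝ) (φ : ℕ → ℕ)
        (W : ℝ → EuclideanSpace ℝ (Fin 3) → EuclideanSpace ℝ (Fin 3)),
      StrictMono φ → (∀ k : ℕ, 0 < M k) → (∀ k : ℕ, tc k ∈ Ico 0 T) →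
      (∀ k : ℕ, T - 1 / ((k : ℝ) + 1) < tc k) →
      (∀ k : ℕ, (k : ℝ) * Real.sqrt ν ≤ M k * Real.sqrt (T - tc k)) →
      (∀ k : ℕ, Icc (tc k - (k : ℝ) * ν / M k ^ 2) (tc k + (k : ℝ) * ν / M k ^ 2) ⊆ Ioo 0 T) →
      (∀ k : ℕ, ∀ s ∈ Icc (tc k - (k : ℝ) * ν / M k ^ 2) (tc k + (k : ℝ) * ν / M k ^ 2),
        ∀ x, ‖u s x‖ ≤ M k) →
      (∀ k : ℕ, M k ≤ 4 * ‖u (tc k) (xc k)‖) →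
      ContDiff ℝ (⊤ : ℕ∞) (uncurry W) → (∀ t, VectorCalculus.IsDivFree (W t)) →
      (∀ s t : ℝ, s < t → ∀ x, W t x = heatFlow (W s) (t - s) x - oseenDuhamel 1 s W W t x) →
      (∀ t x, ‖W t x‖ ≤ 1) →
      (∀ t x, Tendsto
        (fun j => ((M (φ j))⁻¹ • stPull (ν / M (φ j) ^ 2) (ν / M (φ j)) (tc (φ j)) (xc (φ j)) u) t x)
        atTop (𝓝 (W t x))) →
      (∀ t x, Tendsto
        (fun j => fderiv ℝ
          (((M (φ j))⁻¹ • stPull (ν / M (φ j) ^ 2) (ν / M (φ j)) (tc (φ j)) (xc (φ j)) u) t) x)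
        atTop (𝓝 (fderiv ℝ (W t) x))) →
      W 0 0 = 0) :
    Summit.NavierStokesRegularity.NavierStokesRegularity.Theses.TypeILiouville.TypeIliouvilleNoTypeII := by
  intro ν T hν hT u p hmax hLH hdec
  by_contra hII
  obtain ⟨tc, xc, M, φ, W, hφ, hM, htI, hlate, hsig, hsub, hbd, hnear, hWs, hWdiv, hWmild, hWbd,
    h0, hval, hgrad⟩ :=
    exists_eternalProfile_of_not_isTypeIBlowup ν T hν hT u p hmax hLH hdec hII
  have hz := hL ν T hν hT u p hmax hLH hdec tc xc M φ W hφ hM htI hlate hsig hsub hbd hnear hWs hWdiv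
    hWmild hWbd hval hgrad
  rw [hz, norm_zero] at h0
  linarith

end Summit.NavierStokesRegularity.NavierStokesRegularity.Theorems.TypeIliouvilleNoTypeII.EternalProfile

end
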